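import Mathlib
import Literature.NumberTheory.Transcendental.LandauDefectLatticeTate
import Literature.RingTheory.PowerSeries.LaurentSeriesDerivation

/-!
# Crux `InverseLandauRationalCurves`, line `Sketch` — stub FC: the Tate expansion calculus

Item stmt-KontsevichZagierPeriods-13872, stub `stub_tateExpansionCalculus`: for a Tate family
`P/Q` (`P, Q ∈ k[z][ϖ]`), `u = Q⁻¹ ∈ k[z]⟦ϖ⟧` and `J(i, m) = ∫₀¹ zⁱ uᵐ dz ∈ k⟦ϖ⟧ ⊂ k⸨ϖ⸩`:
(a) absorption, (b) commutation with `d/dϖ`, (c) the termwise fundamental theorem of calculus,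
(d) the reading of `∫ G = 0`. Everything is first proved in `k[z]⟦ϖ⟧` for an arbitrary
`k`-linear functional `φ : k[z] → k` applied coefficientwise (`Φ`) and the coefficientwise `d/dz`
(`Dz`), via the dictionary `k[z][ϖ] ⊂ k[z]⟦ϖ⟧` versus the swapped ring `k[ϖ][z]`
(`tateCalc_coe_eq_sum_swap`), then pushed to `k⸨ϖ⸩` along `HahnSeries.ofPowerSeries`; (c) uses
`φ(p′) = p(1) - p(0)`, valid for `φ = ∫₀¹` (`tateCalc_integral_derivative`).
-/

noncomputable section

open Polynomial Literature.NumberTheory.Transcendental.AyoubRel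
open scoped LaurentSeries

namespace Summit.KontsevichZagierPeriods.InverseLandau.RationalCurves

variable {k : Type*} [Field k]

/-- Leibniz rule for `PowerSeries.derivative`, by name (over the base `k[z]` the generic
`Derivation` lemma meets the two `Algebra k[z] k[z]⟦ϖ⟧` structures of Mathlib). -/
theorem tateCalc_pderiv_mul {R : Type*} [CommSemiring R] (f g : PowerSeries R) :
    PowerSeries.derivative R (f * g) =
      PowerSeries.derivative R f * g + f * PowerSeries.derivative R g := by
  rw [(PowerSeries.derivative R).leibniz, smul_eq_mul, smul_eq_mul]; ring

/-- The embedding `k[ϖ][z] → k[z]⟦ϖ⟧`, `Σ_l q_l(ϖ) zˡ ↦ Σ_l (map C q_l) · C(zˡ)`, is a ring hom. -/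
theorem tateCalc_emb_eq_sum (R : Polynomial (Polynomial k)) :
    ∑ l ∈ R.support, PowerSeries.map (C : k →+* k[X]) (R.coeff l : PowerSeries k) *
        PowerSeries.C (X ^ l : k[X]) =
      eval₂RingHom ((PowerSeries.map (C : k →+* k[X])).comp coeToPowerSeries.ringHom)
        (PowerSeries.C (X : k[X])) R := by
  rw [coe_eval₂RingHom, eval₂_eq_sum, sum_def]
  exact Finset.sum_congr rfl fun l _ => by rw [← map_pow]; rfl

/-- **Dictionary.** `R ∈ k[z][ϖ]`, viewed in `k[z]⟦ϖ⟧`, equals `Σ_l (map C q_l) · C(zˡ)` where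
`Σ_l q_l(ϖ) zˡ ∈ k[ϖ][z]` is its swap: two ring homomorphisms out of `k[z][ϖ]` agree. -/
theorem tateCalc_coe_eq_sum_swap (R : Polynomial (Polynomial k)) :
    (R : PowerSeries (Polynomial k)) =
      ∑ l ∈ (eval₂ (mapRingHom (C : k →+* k[X])) (C X) R).support,
        PowerSeries.map (C : k →+* k[X])
            ((eval₂ (mapRingHom (C : k →+* k[X])) (C X) R).coeff l : PowerSeries k) *
          PowerSeries.C (X ^ l : k[X]) := by
  have hgC : ((PowerSeries.map (C : k →+* k[X])).comp coeToPowerSeries.ringHom).comp C =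
      (PowerSeries.C (R := k[X])).comp C := by
    refine RingHom.ext fun b => ?_
    simp only [RingHom.coe_comp, Function.comp_apply, coeToPowerSeries.ringHom_apply,
      Polynomial.coe_C, PowerSeries.map_C]
  have key : (eval₂RingHom ((PowerSeries.map (C : k →+* k[X])).comp coeToPowerSeries.ringHom)
        (PowerSeries.C (X : k[X]))).comp (eval₂RingHom (mapRingHom (C : k →+* k[X])) (C X)) =
      coeToPowerSeries.ringHom := by
    refine Polynomial.ringHom_ext (fun a => ?_) ?_
    · rw [RingHom.comp_apply, coe_eval₂RingHom, coe_eval₂RingHom, eval₂_C, coe_mapRingHom,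
        eval₂_map, hgC, ← hom_eval₂, eval₂_C_X, coeToPowerSeries.ringHom_apply, Polynomial.coe_C]
    · rw [RingHom.comp_apply, coe_eval₂RingHom, coe_eval₂RingHom, eval₂_X, eval₂_C,
        coeToPowerSeries.ringHom_apply, Polynomial.coe_X, RingHom.comp_apply,
        coeToPowerSeries.ringHom_apply, Polynomial.coe_X, PowerSeries.map_X]
  have h := DFunLike.congr_fun key R
  rw [RingHom.comp_apply, coeToPowerSeries.ringHom_apply] at h
  rw [tateCalc_emb_eq_sum]
  exact h.symm

/-- `d/dϖ` of an embedded element of `k[ϖ][z]` differentiates the coefficients `q_l(ϖ)`. -/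
theorem tateCalc_derivative_emb (S : Finset ℕ) (c : ℕ → k[X]) :
    PowerSeries.derivative k[X] (∑ l ∈ S, PowerSeries.map (C : k →+* k[X])
        (c l : PowerSeries k) * PowerSeries.C (X ^ l : k[X])) =
      ∑ l ∈ S, PowerSeries.map (C : k →+* k[X]) (derivative (c l) : PowerSeries k) *
        PowerSeries.C (X ^ l : k[X]) := by
  rw [map_sum]
  refine Finset.sum_congr rfl fun l _ => ?_
  rw [tateCalc_pderiv_mul, PowerSeries.derivative_C, mul_zero, add_zero, ← polynomial_map_coe,
    PowerSeries.derivative_coe, Polynomial.derivative_map, polynomial_map_coe]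

section Functional

variable (φ : k[X] →ₗ[k] k) (Φ : PowerSeries k[X] → PowerSeries k)
  (hΦ : ∀ (f : PowerSeries k[X]) (n : ℕ), PowerSeries.coeff n (Φ f) = φ (PowerSeries.coeff n f))
include hΦ

/-- `Φ` commutes with subtraction. -/
theorem tateCalc_Φ_sub (f g : PowerSeries k[X]) : Φ (f - g) = Φ f - Φ g := by
  ext n; rw [map_sub, hΦ, hΦ, hΦ, map_sub, map_sub]

/-- `Φ` commutes with finite sums. -/
theorem tateCalc_Φ_sum {ι : Type*} (s : Finset ι) (f : ι → PowerSeries k[X]) :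
    Φ (∑ i ∈ s, f i) = ∑ i ∈ s, Φ (f i) := by
  ext n; rw [hΦ, map_sum, map_sum, map_sum]
  exact Finset.sum_congr rfl fun i _ => (hΦ _ _).symm

/-- `k⟦ϖ⟧`-linearity of `Φ`: `Φ((map C g) · f) = g · Φ(f)`. -/
theorem tateCalc_Φ_mapC_mul (g : PowerSeries k) (f : PowerSeries k[X]) :
    Φ (PowerSeries.map (C : k →+* k[X]) g * f) = g * Φ f := by
  ext n; rw [hΦ, PowerSeries.coeff_mul, PowerSeries.coeff_mul, map_sum]
  refine Finset.sum_congr rfl fun p _ => ?_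
  rw [PowerSeries.coeff_map, Polynomial.C_mul', map_smul, hΦ, smul_eq_mul]

/-- `Φ` commutes with multiplication by natural numbers. -/
theorem tateCalc_Φ_natCast_mul (m : ℕ) (f : PowerSeries k[X]) :
    Φ ((m : PowerSeries k[X]) * f) = (m : PowerSeries k) * Φ f := by
  simpa only [map_natCast] using tateCalc_Φ_mapC_mul φ Φ hΦ (m : PowerSeries k) f

/-- The key linearity computation:
`Σ_{l ∈ S} c_l · Φ(z^{i+l} f) = Φ(zⁱ · (Σ_l (map C c_l) C(zˡ)) · f)`. -/
theorem tateCalc_Φ_key (S : Finset ℕ) (c : ℕ → k[X]) (i : ℕ) (f : PowerSeries k[X]) :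
    ∑ l ∈ S, (c l : PowerSeries k) * Φ (PowerSeries.C (X ^ (i + l) : k[X]) * f) =
      Φ (PowerSeries.C (X ^ i : k[X]) * (∑ l ∈ S, PowerSeries.map (C : k →+* k[X])
        (c l : PowerSeries k) * PowerSeries.C (X ^ l : k[X])) * f) := by
  rw [Finset.mul_sum, Finset.sum_mul, tateCalc_Φ_sum φ Φ hΦ]
  refine Finset.sum_congr rfl fun l _ => ?_
  rw [← tateCalc_Φ_mapC_mul φ Φ hΦ, pow_add, map_mul]
  congr 1
  ring

/-- `Φ` commutes with `d/dϖ`. -/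
theorem tateCalc_Φ_derivative (F : PowerSeries k[X]) :
    Φ (PowerSeries.derivative k[X] F) = PowerSeries.derivative k (Φ F) := by
  ext n
  rw [hΦ, PowerSeries.coeff_derivative, PowerSeries.coeff_derivative, hΦ,
    show ((n : k[X]) + 1) = C ((n : k) + 1) by rw [map_add, map_natCast, map_one], mul_comm,
    Polynomial.C_mul', map_smul, smul_eq_mul, mul_comm]

end Functional

section Dz

variable (Dz : PowerSeries k[X] → PowerSeries k[X])
  (hDz : ∀ (f : PowerSeries k[X]) (n : ℕ),
    PowerSeries.coeff n (Dz f) = derivative (PowerSeries.coeff n f))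
include hDz

/-- `Dz` (coefficientwise `d/dz`) is additive. -/
theorem tateCalc_Dz_add (f g : PowerSeries k[X]) : Dz (f + g) = Dz f + Dz g := by
  refine PowerSeries.ext fun n => ?_
  rw [map_add, hDz, hDz, hDz, map_add, map_add]

/-- Leibniz rule for `Dz`. -/
theorem tateCalc_Dz_mul (f g : PowerSeries k[X]) : Dz (f * g) = Dz f * g + f * Dz g := by
  refine PowerSeries.ext fun n => ?_
  rw [hDz, map_add, PowerSeries.coeff_mul, PowerSeries.coeff_mul, PowerSeries.coeff_mul,
    map_sum, ← Finset.sum_add_distrib]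
  refine Finset.sum_congr rfl fun p _ => ?_
  rw [Polynomial.derivative_mul, hDz, hDz]

/-- `Dz` on constants (in `ϖ`): `Dz (C p) = C (p′)`. -/
theorem tateCalc_Dz_C (p : k[X]) : Dz (PowerSeries.C p) = PowerSeries.C (derivative p) := by
  refine PowerSeries.ext fun n => ?_
  by_cases hn : n = 0 <;> simp [hDz, PowerSeries.coeff_C, hn]

/-- `Dz 1 = 0`. -/
theorem tateCalc_Dz_one : Dz 1 = 0 := by
  rw [← map_one (PowerSeries.C (R := k[X])), tateCalc_Dz_C Dz hDz, derivative_one, map_zero]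

/-- `Dz` kills series whose coefficients are constant polynomials. -/
theorem tateCalc_Dz_mapC (g : PowerSeries k) : Dz (PowerSeries.map (C : k →+* k[X]) g) = 0 := by
  refine PowerSeries.ext fun n => ?_
  rw [hDz, PowerSeries.coeff_map, Polynomial.derivative_C, map_zero]

/-- `Dz (f^{n+1}) = (n+1) fⁿ Dz(f)`. -/
theorem tateCalc_Dz_pow_succ (f : PowerSeries k[X]) (n : ℕ) :
    Dz (f ^ (n + 1)) = (n + 1 : PowerSeries k[X]) * f ^ n * Dz f := by
  induction n with
  | zero => rw [zero_add, pow_one, pow_zero, Nat.cast_zero, zero_add, one_mul, one_mul]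
  | succ n ih => rw [pow_succ, tateCalc_Dz_mul Dz hDz, ih]; push_cast; ring

/-- `Dz` of an embedded `R′ ∈ k[ϖ][z]` is the embedding of `∂R′/∂z`. -/
theorem tateCalc_Dz_emb (R' : Polynomial (Polynomial k)) :
    Dz (∑ l ∈ R'.support, PowerSeries.map (C : k →+* k[X]) (R'.coeff l : PowerSeries k) *
        PowerSeries.C (X ^ l : k[X])) =
      ∑ l ∈ (derivative R').support, PowerSeries.map (C : k →+* k[X])
        ((derivative R').coeff l : PowerSeries k) * PowerSeries.C (X ^ l : k[X]) := by
  rw [tateCalc_emb_eq_sum, tateCalc_emb_eq_sum]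
  induction R' using Polynomial.induction_on' with
  | add p q hp hq => rw [map_add, tateCalc_Dz_add Dz hDz, hp, hq, map_add, map_add]
  | monomial n a =>
    rw [← C_mul_X_pow_eq_monomial, derivative_C_mul, derivative_X_pow, map_mul, map_mul,
      map_mul, map_pow, map_pow, coe_eval₂RingHom, eval₂_C, eval₂_X, eval₂_C, map_natCast,
      ← map_pow, ← map_pow, tateCalc_Dz_mul Dz hDz, tateCalc_Dz_C Dz hDz, derivative_X_pow,
      map_mul, map_natCast, map_natCast, RingHom.comp_apply, coeToPowerSeries.ringHom_apply,
      tateCalc_Dz_mapC Dz hDz, zero_mul, zero_add]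

end Dz

/-- The fundamental theorem of calculus for `∫₀¹` on `k[z]`: `Σ_j [zʲ](p′)/(j+1) = p(1) - p(0)`. -/
theorem tateCalc_integral_derivative [CharZero k] (p : k[X]) :
    ((derivative p).sum fun j a => a / ((j : k) + 1)) = eval 1 p - eval 0 p := by
  have hdeg : (derivative p).natDegree < p.natDegree + 1 :=
    lt_of_le_of_lt (natDegree_derivative_le p) (by omega)
  rw [sum_over_range' (f := fun j a => a / ((j : k) + 1)) _ (fun j => zero_div _) _ hdeg,
    eval_eq_sum_range' (show p.natDegree < p.natDegree + 1 + 1 by omega),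
    ← coeff_zero_eq_eval_zero, Finset.sum_range_succ' _ (p.natDegree + 1)]
  simp only [one_pow, mul_one, add_sub_cancel_right]
  refine Finset.sum_congr rfl fun j _ => ?_
  rw [coeff_derivative, mul_div_assoc, div_self (Nat.cast_add_one_ne_zero j), mul_one]

/-- The integration functional `p ↦ Σ_j [zʲ]p/(j+1)` as a `k`-linear map (`Polynomial.lsum`). -/
theorem tateCalc_lsum_apply (p : k[X]) :
    (lsum (R := k) (fun j : ℕ => LinearMap.mulRight k (((j : k) + 1)⁻¹)) : k[X] →ₗ[k] k) p =
      p.sum fun j a => a / ((j : k) + 1) := by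
  simp only [lsum, LinearMap.coe_mk, AddHom.coe_mk, LinearMap.mulRight_apply, div_eq_mul_inv]

section Parts

variable (φ : k[X] →ₗ[k] k) (Φ : PowerSeries k[X] → PowerSeries k)
  (hΦ : ∀ (f : PowerSeries k[X]) (n : ℕ), PowerSeries.coeff n (Φ f) = φ (PowerSeries.coeff n f))
  {Q Qs : Polynomial (Polynomial k)} {u : PowerSeries k[X]}
  (hQ : (Q : PowerSeries k[X]) = ∑ l ∈ Qs.support,
    PowerSeries.map (C : k →+* k[X]) (Qs.coeff l : PowerSeries k) * PowerSeries.C (X ^ l : k[X]))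
  (hu : (Q : PowerSeries k[X]) * u = 1)
include hΦ hQ hu

/-- **(a) Absorption** `Σ_l q_l · Φ(z^{i+l} u^{m+1}) = Φ(zⁱ uᵐ)` in `k⸨ϖ⸩` (from `Q u = 1`). -/
theorem tateCalc_partA (i m : ℕ) :
    ∑ l ∈ Qs.support, ((Qs.coeff l : PowerSeries k) : k⸨X⸩) *
        (Φ (PowerSeries.C (X ^ (i + l) : k[X]) * u ^ (m + 1)) : k⸨X⸩) =
      (Φ (PowerSeries.C (X ^ i : k[X]) * u ^ m) : k⸨X⸩) := by
  have key := tateCalc_Φ_key φ Φ hΦ Qs.support Qs.coeff i (u ^ (m + 1))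
  rw [← hQ, show PowerSeries.C (X ^ i : k[X]) * (Q : PowerSeries k[X]) * u ^ (m + 1) =
    PowerSeries.C (X ^ i : k[X]) * u ^ m by
      rw [pow_succ', ← mul_assoc, mul_assoc (PowerSeries.C _) _ u, hu, mul_one]] at key
  rw [← key, map_sum]
  simp only [map_mul]

/-- **(b)** `(Φ(zⁱuᵐ))′ = -m Σ_l q_l′ · Φ(z^{i+l} u^{m+1})` in `k⸨ϖ⸩` (`u′ = -u² Q′`, Leibniz). -/
theorem tateCalc_partB (i m : ℕ) :
    LaurentSeries.derivative k (Φ (PowerSeries.C (X ^ i : k[X]) * u ^ m) : k⸨X⸩) =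
      -(m : k⸨X⸩) * ∑ l ∈ Qs.support, ((derivative (Qs.coeff l) : PowerSeries k) : k⸨X⸩) *
        (Φ (PowerSeries.C (X ^ (i + l) : k[X]) * u ^ (m + 1)) : k⸨X⸩) := by
  have key := tateCalc_Φ_key φ Φ hΦ Qs.support (fun l => derivative (Qs.coeff l)) i
    (u ^ (m + 1))
  beta_reduce at key
  rw [← tateCalc_derivative_emb, ← hQ] at key
  have hdu : PowerSeries.derivative k[X] u =
      -(u * u * PowerSeries.derivative k[X] (Q : PowerSeries k[X])) := by
    have h := congrArg (PowerSeries.derivative k[X]) hu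
    rw [tateCalc_pderiv_mul, ← map_one (PowerSeries.C (R := k[X])), PowerSeries.derivative_C] at h
    linear_combination (-PowerSeries.derivative k[X] u) * hu + u * h
  have hdF : PowerSeries.derivative k[X] (PowerSeries.C (X ^ i : k[X]) * u ^ m) =
      PowerSeries.map (C : k →+* k[X]) (-(m : PowerSeries k)) * (PowerSeries.C (X ^ i : k[X]) *
        PowerSeries.derivative k[X] (Q : PowerSeries k[X]) * u ^ (m + 1)) := by
    rw [tateCalc_pderiv_mul, PowerSeries.derivative_C, zero_mul, zero_add,
      PowerSeries.derivative_pow, hdu, map_neg, map_natCast]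
    rcases m with _ | m
    · simp
    · rw [Nat.add_sub_cancel]; push_cast; ring
  rw [Literature.RingTheory.PowerSeries.derivative_coe_powerSeries,
    ← tateCalc_Φ_derivative φ Φ hΦ, hdF, tateCalc_Φ_mapC_mul φ Φ hΦ, ← key, map_mul, map_neg,
    map_natCast, map_sum]
  simp only [map_mul]

omit hQ in
/-- **(d)** `Φ(G) = 0` for `Q G = P` reads `Σ_i p_i · Φ(zⁱ u) = 0` in `k⸨ϖ⸩` (`G = P u`). -/
theorem tateCalc_partD {P Ps : Polynomial (Polynomial k)}
    (hP : (P : PowerSeries k[X]) = ∑ l ∈ Ps.support,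
      PowerSeries.map (C : k →+* k[X]) (Ps.coeff l : PowerSeries k) * PowerSeries.C (X ^ l : k[X]))
    (G : PowerSeries k[X]) (hG : (Q : PowerSeries k[X]) * G = P) (hG0 : Φ G = 0) :
    ∑ i ∈ Ps.support, ((Ps.coeff i : PowerSeries k) : k⸨X⸩) *
        (Φ (PowerSeries.C (X ^ i : k[X]) * u ^ 1) : k⸨X⸩) = 0 := by
  have key := tateCalc_Φ_key φ Φ hΦ Ps.support Ps.coeff 0 (u ^ 1)
  rw [← hP, pow_zero, map_one, one_mul, ← hG, show (Q : PowerSeries k[X]) * G * u ^ 1 = G by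
    rw [pow_one, mul_right_comm, hu, one_mul], hG0] at key
  simp only [zero_add] at key
  have h := congrArg (HahnSeries.ofPowerSeries ℤ k) key
  rw [map_sum, map_zero] at h
  simpa only [map_mul] using h

variable (Dz : PowerSeries k[X] → PowerSeries k[X])
  (hDz : ∀ (f : PowerSeries k[X]) (n : ℕ),
    PowerSeries.coeff n (Dz f) = derivative (PowerSeries.coeff n f))
  (hφ : ∀ p : k[X], φ (derivative p) = eval 1 p - eval 0 p)
include hDz hφ

/-- **(c) Termwise FTC** in `k⸨ϖ⸩` for a functional with `φ(p′) = p(1) - p(0)`: the left side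
`i Φ(z^{i-1} uⁿ) - n Σ_l (∂_z Q)_l Φ(z^{i+l} u^{n+1})` is `Φ(∂_z(zⁱ uⁿ))`; `u(c, ϖ) = Q(c, ϖ)⁻¹`. -/
theorem tateCalc_partC (i n : ℕ) :
    (i : k⸨X⸩) * (Φ (PowerSeries.C (X ^ (i - 1) : k[X]) * u ^ n) : k⸨X⸩) -
        (n : k⸨X⸩) * ∑ l ∈ (derivative Qs).support,
          (((derivative Qs).coeff l : PowerSeries k) : k⸨X⸩) *
            (Φ (PowerSeries.C (X ^ (i + l) : k[X]) * u ^ (n + 1)) : k⸨X⸩) =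
      ((algebraMap (Polynomial k) (RatFunc k) (Q.map (evalRingHom 1)))⁻¹ ^ n : RatFunc k) -
        (if i = 0 then
          (((algebraMap (Polynomial k) (RatFunc k) (Q.map (evalRingHom 0)))⁻¹ ^ n :
            RatFunc k) : k⸨X⸩) else 0) := by
  have key := tateCalc_Φ_key φ Φ hΦ (derivative Qs).support (derivative Qs).coeff i (u ^ (n + 1))
  rw [show ∑ l ∈ (derivative Qs).support, PowerSeries.map (C : k →+* k[X])
      ((derivative Qs).coeff l : PowerSeries k) * PowerSeries.C (X ^ l : k[X]) =
      Dz (Q : PowerSeries k[X]) by rw [hQ, tateCalc_Dz_emb Dz hDz]] at key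
  have hDzu : Dz u = -(u * u * Dz (Q : PowerSeries k[X])) := by
    have h := congrArg Dz hu
    rw [tateCalc_Dz_mul Dz hDz, tateCalc_Dz_one Dz hDz] at h
    linear_combination (-Dz u) * hu + u * h
  have hDzF : Dz (PowerSeries.C (X ^ i : k[X]) * u ^ n) =
      (i : PowerSeries k[X]) * (PowerSeries.C (X ^ (i - 1) : k[X]) * u ^ n) -
        (n : PowerSeries k[X]) *
          (PowerSeries.C (X ^ i : k[X]) * Dz (Q : PowerSeries k[X]) * u ^ (n + 1)) := by
    rw [tateCalc_Dz_mul Dz hDz, tateCalc_Dz_C Dz hDz, derivative_X_pow, map_mul, map_natCast,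
      map_natCast]
    rcases n with _ | n
    · rw [pow_zero, tateCalc_Dz_one Dz hDz]; simp
    · rw [tateCalc_Dz_pow_succ Dz hDz, hDzu]; push_cast; ring
  have hFTC : ∀ F : PowerSeries k[X], Φ (Dz F) =
      PowerSeries.map (evalRingHom 1) F - PowerSeries.map (evalRingHom 0) F := fun F => by
    ext m
    rw [hΦ, hDz, hφ, map_sub, PowerSeries.coeff_map, PowerSeries.coeff_map, coe_evalRingHom,
      coe_evalRingHom]
  have main := congrArg (fun x => (i : PowerSeries k) *
    Φ (PowerSeries.C (X ^ (i - 1) : k[X]) * u ^ n) - (n : PowerSeries k) * x) key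
  beta_reduce at main
  rw [← tateCalc_Φ_natCast_mul φ Φ hΦ n, ← tateCalc_Φ_natCast_mul φ Φ hΦ i,
    ← tateCalc_Φ_sub φ Φ hΦ, ← hDzF, hFTC, tateCalc_Φ_natCast_mul φ Φ hΦ i] at main
  have hev : ∀ c : k, ((PowerSeries.map (evalRingHom c) (PowerSeries.C (X ^ i : k[X]) * u ^ n) :
      PowerSeries k) : k⸨X⸩) = HahnSeries.C (c ^ i) *
        (((algebraMap (Polynomial k) (RatFunc k) (Q.map (evalRingHom c)))⁻¹ ^ n : RatFunc k) :
          k⸨X⸩) := fun c => by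
    have h := congrArg (fun F => ((PowerSeries.map (evalRingHom c) F : PowerSeries k) : k⸨X⸩)) hu
    simp only [map_mul, map_one, ← polynomial_map_coe, RatFunc.coe_coe] at h
    rw [map_mul, PowerSeries.map_C, map_pow (PowerSeries.map _), coe_evalRingHom, eval_pow,
      eval_X, map_mul, HahnSeries.ofPowerSeries_C, map_pow (HahnSeries.ofPowerSeries ℤ k),
      eq_inv_of_mul_eq_one_right h, ← map_inv₀, ← map_pow]
    rfl
  have main' := congrArg (HahnSeries.ofPowerSeries ℤ k) main
  simp only [map_sub, hev, one_pow, map_one, one_mul, zero_pow_eq] at main'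
  split_ifs at main' with hi <;> simp only [map_one, one_mul, map_zero, zero_mul] at main' <;>
    simpa [hi, map_sum] using main'

end Parts

/-- **Tate expansion calculus** (`let`-free form of the registered stub: the abbreviations
`J`, `Qs`, `Ps` are universally quantified with defining hypotheses `hJ`, `hQs`, `hPs`). Write
`Q = Σ_l q_l(ϖ) z^l`, `P = Σ_i p_i(ϖ) z^i` (`q_l, p_i ∈ k[ϖ]`, via the swap `k[z][ϖ] → k[ϖ][z]`),
let `u = Q⁻¹ ∈ k[z]⟦ϖ⟧` and `J(i, m) := ∫₀¹ zⁱ u^m dz ∈ k⟦ϖ⟧ ⊂ k((ϖ))` (coefficientwise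
`∫₀¹ zʲ dz = 1/(j+1)`). Then: (absorption) `Σ_l q_l · J(i+l, m+1) = J(i, m)`; (parameter
derivative) `d/dϖ J(i, m) = -m · Σ_l q_l′ · J(i+l, m+1)`; (termwise FTC)
`i · J(i-1, n) - n · Σ_l (l+1) q_{l+1} · J(i+l, n+1) = Q(1,ϖ)^{-n} - [i = 0] · Q(0,ϖ)^{-n}`;
(hypothesis) `∫ G = 0` reads `Σ_i p_i · J(i, 1) = 0`. -/
theorem stub_tateExpansionCalculus
    {k : Type*} [Field k] [CharZero k] (T : TateFamily₁ k) (u : PowerSeries (Polynomial k))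
    (hu : (T.Q : PowerSeries (Polynomial k)) * u = 1) (J : ℕ → ℕ → k⸨X⸩)
    (hJ : ∀ i m : ℕ, J i m = ((PowerSeries.mk fun n =>
      (PowerSeries.coeff n (PowerSeries.C (X ^ i : Polynomial k) * u ^ m)).sum
        fun j a => a / ((j : k) + 1) : PowerSeries k) : k⸨X⸩))
    (Qs Ps : Polynomial (Polynomial k))
    (hQs : Qs = Polynomial.eval₂ (Polynomial.mapRingHom (Polynomial.C : k →+* Polynomial k))
      (C X) T.Q)
    (hPs : Ps = Polynomial.eval₂ (Polynomial.mapRingHom (Polynomial.C : k →+* Polynomial k))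
      (C X) T.P) :
    (∀ i m : ℕ, ∑ l ∈ Qs.support, ((Qs.coeff l : PowerSeries k) : k⸨X⸩) * J (i + l) (m + 1) =
        J i m) ∧
    (∀ i m : ℕ, LaurentSeries.derivative k (J i m) =
        -(m : k⸨X⸩) * ∑ l ∈ Qs.support,
          ((derivative (Qs.coeff l) : PowerSeries k) : k⸨X⸩) * J (i + l) (m + 1)) ∧
    (∀ i n : ℕ, (i : k⸨X⸩) * J (i - 1) n -
        (n : k⸨X⸩) * ∑ l ∈ (derivative Qs).support,
          (((derivative Qs).coeff l : PowerSeries k) : k⸨X⸩) * J (i + l) (n + 1) =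
        ((algebraMap (Polynomial k) (RatFunc k) (T.Q.map (evalRingHom 1)))⁻¹ ^ n : RatFunc k) -
          (if i = 0 then
            (((algebraMap (Polynomial k) (RatFunc k) (T.Q.map (evalRingHom 0)))⁻¹ ^ n :
              RatFunc k) : k⸨X⸩) else 0)) ∧
    (∀ G : PowerSeries (Polynomial k), (T.Q : PowerSeries (Polynomial k)) * G = T.P →
      (∀ j : ℕ, (PowerSeries.coeff j G).sum (fun i a => a / ((i : k) + 1)) = 0) →
      ∑ i ∈ Ps.support, ((Ps.coeff i : PowerSeries k) : k⸨X⸩) * J i 1 = 0) := by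
  subst hQs hPs
  let φ : k[X] →ₗ[k] k := lsum (R := k) (fun j : ℕ => LinearMap.mulRight k (((j : k) + 1)⁻¹))
  let Φ : PowerSeries k[X] → PowerSeries k := fun F =>
    PowerSeries.mk fun n => (PowerSeries.coeff n F).sum fun j a => a / ((j : k) + 1)
  have hΦ : ∀ (F : PowerSeries k[X]) (n : ℕ), PowerSeries.coeff n (Φ F) =
      φ (PowerSeries.coeff n F) := fun F n => by rw [PowerSeries.coeff_mk, tateCalc_lsum_apply]
  have hφ : ∀ p : k[X], φ (derivative p) = eval 1 p - eval 0 p := fun p => by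
    rw [tateCalc_lsum_apply]; exact tateCalc_integral_derivative p
  let Dz : PowerSeries k[X] → PowerSeries k[X] := fun F =>
    PowerSeries.mk fun n => derivative (PowerSeries.coeff n F)
  have hDz : ∀ (F : PowerSeries k[X]) (n : ℕ), PowerSeries.coeff n (Dz F) =
      derivative (PowerSeries.coeff n F) := fun F n => PowerSeries.coeff_mk _ _
  have hQ := tateCalc_coe_eq_sum_swap T.Q
  simp only [hJ]
  refine ⟨fun i m => tateCalc_partA φ Φ hΦ hQ hu i m, fun i m => tateCalc_partB φ Φ hΦ hQ hu i m,
    fun i n => tateCalc_partC φ Φ hΦ hQ hu Dz hDz hφ i n, fun G hG hG0 => ?_⟩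
  exact tateCalc_partD φ Φ hΦ hu (tateCalc_coe_eq_sum_swap T.P) G hG
    (PowerSeries.ext fun j => by rw [PowerSeries.coeff_mk, map_zero]; exact hG0 j)

end Summit.KontsevichZagierPeriods.InverseLandau.RationalCurves

end
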